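import Summits.BirchSwinnertonDyer.BirchSwinnertonDyer.Theorems.ByReductionTypeAtTwoFineSelmerConjAAtTwoAdditivePotGoodClassNumberOneCriterionFrac
import Literature.NumberTheory.NumberFields.ClassGroupCertDK
import HarnessLib

/-!
# Route `ByReductionTypeAtTwo` (rung K4), crux C1″ `FineSelmerConjAAtTwoAdditivePotGood` (item stmt-BirchSwinnertonDyer-22615):
# AN ODD-CLASS-NUMBER CRITERION FOR CUBIC FIELDS — cube certificates `I³ = (α)` for the ideals of prime norm below the Minkowski
# bound, with a Dedekind–Kummer-free «`I` is the only prime containing `α`» argument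
# (a `--supports 22615` toolkit file; seat `bsd-2adic-k4-w1` GEN 6; sequel of `…ClassNumberOneCriterionFrac`)

HONEST FRAMING (cell `bsd-2adic`, D-0036/D-0054): UNCONDITIONAL kernel lemmas about cubic number fields; closes nothing; nothing booked;
BSD is not proved by any of this.

PURPOSE: five census rows of C1″ have a `2`-torsion cubic field `ℚ(P)` with `h = 3` (census `cyc3 = [3]`: 333036e1, 365400bs1, 451440ch1,
474320im1, 413952bm1); their displayed bit is `2 ∤ h(ℚ(P))`. The class-number-ONE criterion cannot decide it; this file gives the odd variant:

* `odd_classNumber_of_cubeCertificate` — if `M_K < B` and every ideal of prime norm `ℓ < B` has a principal CUBE, then `h_K` is odd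
  (the class group is generated by the primes of norm `≤ M_K` — Mathlib `exists_ideal_in_class_of_norm_le` and prime factorisation via
  `Literature.…ClassIn.of_prime_factors` — each of which then has order dividing `3`; `N(P) = ℓ²` reduces to norm `ℓ` through `(ℓ) = P · J`).
* `natCast_dvd_eval_of_sub_mem` — `x + yθ + zθ² ∈ Q`, `θ ≡ a (mod Q)`, `N(Q) = ℓ` ⟹ `ℓ ∣ x + ya + za²`.
* `pow_three_eq_span_of_cert` — **the cube certificate**: an ideal `I` of prime norm `ℓ` with `θ ≡ a (mod I)` satisfies `I³ = (ω)` as soon as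
  `ω = (x + yθ + zθ²)/m ∈ 𝓞 K` (`m` prime to `ℓ`) lies in `I` (`ℓ ∣ x + ya + za²`), has `|N| = ℓ³`, is SEPARATED from the other residues
  (`ℓ ∤ x + ya' + za'²` for the other roots `a'`), satisfies an identity `U(θ) · (x + yθ + zθ²) = (θ − a) + ℓ · W(θ)` (from Bézout mod `ℓ`:
  `ω` lies in no prime of degree `≥ 2` above `ℓ`), and `ℓ² ∤ g(a + ℓt)` for some integer `t` (simple root). Then every prime `Q ∋ ω` equals
  `I`: otherwise `θ − (a + ℓt) ∈ Q ⊓ I = Q · I`, whose norm `ℓ^{≥2}` would divide `N(θ − a − ℓt) = ∓g(a + ℓt)`. Hence `(ω) = I³`.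
* `not_two_dvd_card_classGroup_adjoin_of_forall_cubicField_odd` — transport to `ℚ(θ) ⊂ ℚ̄`.

References: [Marcus1977] Ch. 3 Thm. 22, Ch. 5 Thm. 35–37 and the class-group computations after Cor. 2; [Cohen1993] §4.8.2, §6.3;
[Neukirch1999] I.§3 (unique factorisation, coprime maximal ideals).
-/

set_option autoImplicit false
-- sibling precedent (`…ClassNumberOneCriterionFrac.lean`): the directory name repeats the summit name
set_option linter.dupNamespace false

noncomputable section

open scoped Classical IntermediateField NumberField Real nonZeroDivisors

namespace Summit.BirchSwinnertonDyer.BirchSwinnertonDyer.Theorems.AddKatoTwo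

open Polynomial IsDedekindDomain NumberField Matrix UniqueFactorizationMonoid

variable (K : Type) [Field K] [NumberField K]

/-! ## §1 Odd class number from cube certificates -/

/-- **`h_K` is odd as soon as `M_K < B` and every ideal of prime norm `ℓ < B` has a principal cube** (cubic `K`). Every class contains an
ideal of norm `≤ M_K`; its prime factors `P` have `N(P) ∈ {ℓ, ℓ², ℓ³}` with `ℓ < B` and `P³` principal (`N = ℓ²`: `(ℓ) = P·J`, `J³ = (β)`,
`ℓ³ = βγ`, `P³ = (γ)`; `N = ℓ³`: `P = (ℓ)`), so every class `c` has `c³ = 1` and the class number is odd.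
[cite: Marcus1977, Ch. 5 Thm. 35–37 and Cor. 2] -/
theorem odd_classNumber_of_cubeCertificate (h3 : Module.finrank ℚ K = 3) {B : ℕ}
    (hM : (4 / π) ^ NumberField.InfinitePlace.nrComplexPlaces K *
      ((Module.finrank ℚ K).factorial / (Module.finrank ℚ K : ℝ) ^ Module.finrank ℚ K * √|(NumberField.discr K : ℝ)|) < B)
    (hcube : ∀ ℓ : ℕ, ℓ < B → ℓ.Prime → ∀ I : Ideal (𝓞 K), Ideal.absNorm I = ℓ → ∃ α : 𝓞 K, I ^ 3 = Ideal.span {α}) :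
    Odd (NumberField.classNumber K) := by
  -- every non-zero prime of norm `< B` has a principal cube
  have hprime : ∀ P : Ideal (𝓞 K), P.IsPrime → P ≠ ⊥ → Ideal.absNorm P < B → ∃ α : 𝓞 K, P ^ 3 = Ideal.span {α} := by
    intro P hP hP0 hPB
    obtain ⟨ℓ, hℓ, hℓP, i, hi1, hi3, hN⟩ := exists_prime_natCast_mem K h3 hP hP0
    have hℓB : ℓ < B := lt_of_le_of_lt (by rw [hN]; exact Nat.le_self_pow (by omega) ℓ) hPB
    interval_cases i
    · rw [pow_one] at hN
      exact hcube ℓ hℓB hℓ P hN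
    · obtain ⟨J, hJ⟩ : P ∣ Ideal.span {((ℓ : ℕ) : 𝓞 K)} :=
        Ideal.dvd_iff_le.mpr ((Ideal.span_singleton_le_iff_mem P).mpr hℓP)
      have hNℓ : Ideal.absNorm (Ideal.span {((ℓ : ℕ) : 𝓞 K)}) = ℓ ^ 3 := by
        rw [Ideal.absNorm_span_singleton]
        have : ((ℓ : ℕ) : 𝓞 K) = algebraMap ℤ (𝓞 K) ℓ := by simp
        rw [this, Algebra.norm_algebraMap, NumberField.RingOfIntegers.rank, h3, Int.natAbs_pow]
        simp
      have hJN : Ideal.absNorm J = ℓ := by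
        have h := congrArg Ideal.absNorm hJ
        rw [hNℓ, map_mul, hN, pow_succ] at h
        exact (Nat.eq_of_mul_eq_mul_left (pow_pos hℓ.pos 2) h).symm
      obtain ⟨β, hβ⟩ := hcube ℓ hℓB hℓ J hJN
      have h3J : Ideal.span {((ℓ : ℕ) : 𝓞 K) ^ 3} = P ^ 3 * Ideal.span {β} := by
        rw [← Ideal.span_singleton_pow, hJ, mul_pow, hβ]
      have hmem : ((ℓ : ℕ) : 𝓞 K) ^ 3 ∈ Ideal.span {β} := by
        have : ((ℓ : ℕ) : 𝓞 K) ^ 3 ∈ P ^ 3 * Ideal.span {β} := by rw [← h3J]; exact Ideal.mem_span_singleton_self _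
        exact Ideal.mul_le_left this
      obtain ⟨γ, hγ⟩ := Ideal.mem_span_singleton'.mp hmem
      have hβ0 : β ≠ 0 := by
        intro h0
        rw [h0] at hβ
        have : Ideal.absNorm (J ^ 3) = 0 := by rw [hβ, Ideal.span_singleton_eq_bot.mpr rfl, Ideal.absNorm_bot]
        rw [map_pow, hJN] at this
        exact pow_ne_zero 3 hℓ.ne_zero this
      refine ⟨γ, mul_right_cancel₀ ((Ideal.span_singleton_eq_bot.not).mpr hβ0) ?_⟩
      rw [← h3J, Ideal.span_singleton_mul_span_singleton, hγ]
    · have hnorm : (Algebra.norm ℤ ((ℓ : ℕ) : 𝓞 K)).natAbs = ℓ ^ 3 := by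
        have : ((ℓ : ℕ) : 𝓞 K) = algebraMap ℤ (𝓞 K) ℓ := by simp
        rw [this, Algebra.norm_algebraMap, NumberField.RingOfIntegers.rank, h3, Int.natAbs_pow]
        simp
      refine ⟨((ℓ : ℕ) : 𝓞 K) ^ 3, ?_⟩
      rw [eq_span_singleton_of_mem_of_absNorm_eq K (pow_ne_zero 3 hℓ.ne_zero) hN hℓP hnorm, Ideal.span_singleton_pow]
  -- hence the `3`-torsion subgroup is everything
  apply Literature.NumberTheory.NumberFields.MonicCubic.odd_classNumber_of_ker3_eq_top
  refine (Subgroup.eq_top_iff' _).mpr fun C => ?_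
  obtain ⟨I, rfl, hI⟩ := NumberField.exists_ideal_in_class_of_norm_le C
  have hIB : Ideal.absNorm (I : Ideal (𝓞 K)) < B := by exact_mod_cast hI.trans_lt hM
  have hcl : Literature.NumberTheory.NumberFields.ClassIn (Literature.NumberTheory.NumberFields.MonicCubic.ker3 K)
      (I : Ideal (𝓞 K)) := by
    refine Literature.NumberTheory.NumberFields.ClassIn.of_prime_factors (nonZeroDivisors.coe_ne_zero I)
      fun Q hQ hQ0 hdvd => ?_
    have hQB : Ideal.absNorm Q < B :=
      lt_of_le_of_lt (Nat.le_of_dvd (Nat.pos_of_ne_zero (Ideal.absNorm_ne_zero_of_nonZeroDivisors I))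
        (Ideal.absNorm_dvd_absNorm_of_le (Ideal.le_of_dvd hdvd))) hIB
    obtain ⟨α, hα⟩ := hprime Q hQ hQ0 hQB
    rw [Literature.NumberTheory.NumberFields.MonicCubic.classIn_ker3_iff (mem_nonZeroDivisors_of_ne_zero hQ0), ← map_pow,
      ClassGroup.mk0_eq_one_iff]
    exact ⟨⟨α, by rw [SubmonoidClass.coe_pow]; exact hα⟩⟩
  have := hcl I.2
  simpa [Literature.NumberTheory.NumberFields.MonicCubic.ker3] using this

/-! ## §2 The cube certificate -/

omit [NumberField K] in
/-- **`ℓ ∣ x + ya + za²`** when `x + yθ + zθ² ∈ Q`, `θ − a ∈ Q` and `N(Q) = ℓ` (`K` cubic): the integer `x + ya + za²` lies in `Q`, and an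
integer `n ∈ Q` has `N(Q) ∣ n³`. [folklore] -/
theorem natCast_dvd_eval_of_sub_mem [NumberField K] (h3 : Module.finrank ℚ K = 3) {Q : Ideal (𝓞 K)} {ℓ : ℕ} (hℓ : ℓ.Prime)
    (hQ : Ideal.absNorm Q = ℓ) {b : 𝓞 K} {a : ℕ} (hba : b - (a : 𝓞 K) ∈ Q) {x y z : ℤ}
    (hT : ((x : 𝓞 K) + y * b + z * b ^ 2) ∈ Q) : (ℓ : ℤ) ∣ x + y * a + z * (a : ℤ) ^ 2 := by
  set n : ℤ := x + y * a + z * (a : ℤ) ^ 2 with hn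
  have hmem : (n : 𝓞 K) ∈ Q := by
    have : (n : 𝓞 K) = ((x : 𝓞 K) + y * b + z * b ^ 2) - (b - (a : 𝓞 K)) * (y + z * (b + a)) := by
      rw [hn]; push_cast; ring
    rw [this]
    exact Q.sub_mem hT (Q.mul_mem_right _ hba)
  have hdvd := Ideal.absNorm_dvd_absNorm_of_le ((Ideal.span_singleton_le_iff_mem _).mpr hmem)
  rw [hQ, Ideal.absNorm_span_singleton] at hdvd
  have hnorm : Algebra.norm ℤ (n : 𝓞 K) = n ^ 3 := by
    have : (n : 𝓞 K) = algebraMap ℤ (𝓞 K) n := by simp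
    rw [this, Algebra.norm_algebraMap, NumberField.RingOfIntegers.rank, h3]
  rw [hnorm, Int.natAbs_pow] at hdvd
  exact Int.ofNat_dvd_left.mpr (Nat.Prime.dvd_of_dvd_pow hℓ hdvd)

/-- **Membership and norm of a fractional witness**: if `θ − a ∈ I`, `N(I) = ℓ` prime, `m` is prime to `ℓ`, `ℓ ∣ x + ya + za²`,
`m ω = x + yθ + zθ²` and `|normPoly(x, y, z)| = m³ n`, then `ω ∈ I` and `|N(ω)| = n`. [cite: Marcus1977, Ch. 5 Thm. 37] -/
theorem mem_and_natAbs_norm_of_fracWitness (h3 : Module.finrank ℚ K = 3) (b : 𝓞 K) {p q r : ℤ}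
    (hirr : Irreducible (Cubic.toPoly ⟨1, (p : ℚ), q, r⟩)) (hb : b ^ 3 + p * b ^ 2 + q * b + r = 0)
    {ℓ : ℕ} (hℓ : ℓ.Prime) {I : Ideal (𝓞 K)} (hI : Ideal.absNorm I = ℓ) {a : ℕ} (hab : b - (a : 𝓞 K) ∈ I)
    {x y z : ℤ} {m : ℕ} (hcop : Nat.Coprime m ℓ) (hdvd : (ℓ : ℤ) ∣ x + y * a + z * (a : ℤ) ^ 2)
    {ω : 𝓞 K} (hω : (m : 𝓞 K) * ω = (x : 𝓞 K) + y * b + z * b ^ 2) {n : ℕ}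
    (hN : (x ^ 3 - p * x ^ 2 * y + (p ^ 2 - 2 * q) * x ^ 2 * z + q * x * y ^ 2 + (3 * r - p * q) * x * y * z
      + (q ^ 2 - 2 * p * r) * x * z ^ 2 - r * y ^ 3 + p * r * y ^ 2 * z - q * r * y * z ^ 2 + r ^ 2 * z ^ 3).natAbs = m ^ 3 * n) :
    ω ∈ I ∧ (Algebra.norm ℤ ω).natAbs = n := by
  have hℓI : ((ℓ : ℕ) : 𝓞 K) ∈ I := by have := Ideal.absNorm_mem I; rwa [hI] at this
  have hIprime : I.IsPrime := Ideal.isPrime_of_irreducible_absNorm (by rw [hI]; exact hℓ)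
  have hTI : ((x : 𝓞 K) + y * b + z * b ^ 2) ∈ I := coords_mem_of_dvd K hℓI hab hdvd
  have hm0 : m ≠ 0 := by
    rintro rfl
    rw [Nat.coprime_zero_left] at hcop
    exact hℓ.one_lt.ne' hcop
  have hmI : ((m : ℕ) : 𝓞 K) ∉ I := by
    intro hmem
    have hd := absNorm_dvd_pow_three_of_natCast_mem K h3 hmem
    rw [hI] at hd
    have : ℓ ∣ m := hℓ.dvd_of_dvd_pow hd
    exact hℓ.one_lt.ne' ((Nat.coprime_self ℓ).mp (Nat.Coprime.coprime_dvd_left this hcop))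
  have hωI : ω ∈ I := by
    have : ((m : ℕ) : 𝓞 K) * ω ∈ I := by rw [hω]; exact hTI
    exact (hIprime.mem_or_mem this).resolve_left hmI
  have hnormT := natAbs_norm_coords_eq_natAbs_normPoly K h3 b hirr hb x y z
  rw [hN, ← hω, map_mul, Int.natAbs_mul] at hnormT
  have hnm : (Algebra.norm ℤ ((m : ℕ) : 𝓞 K)).natAbs = m ^ 3 := by
    have : ((m : ℕ) : 𝓞 K) = algebraMap ℤ (𝓞 K) m := by simp
    rw [this, Algebra.norm_algebraMap, NumberField.RingOfIntegers.rank, h3, Int.natAbs_pow]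
    simp
  rw [hnm] at hnormT
  exact ⟨hωI, Nat.eq_of_mul_eq_mul_left (pow_pos (Nat.pos_of_ne_zero hm0) 3) hnormT⟩

/-- **THE CUBE CERTIFICATE**: an ideal `I` of prime norm `ℓ` has `I³ = (α)` once the certificate supplies, for the residue `a` of `θ` mod
`I` (a root of the cubic mod `ℓ`), EITHER a principal witness (as in `isPrincipal_of_absNorm_eq_prime_frac`) OR a cube witness:
`ω = (x + yθ + zθ²)/m ∈ 𝓞 K` (`m` prime to `ℓ`) with `ℓ ∣ x + ya + za²`, `|normPoly(x, y, z)| = m³ℓ³`, a Bézout identity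
`(u₀ + u₁θ + u₂θ²)(x + yθ + zθ²) = (θ − a)^e + ℓ(w₀ + w₁θ + w₂θ²)` (it says: every prime containing `ω` and `ℓ` contains `θ − a`; it exists iff
`gcd(x + yX + zX², g)` is a power of `X − a` in `𝔽_ℓ[X]`), and an integer `t` with `ℓ² ∤ g(a + ℓt)` (always available at a simple root, and at a
double root exactly when `ℤ[θ]` is `ℓ`-maximal there — Dedekind's criterion, used only as a search heuristic). Then `I` is the ONLY prime containing
`ω`: another one, `Q`, would contain `ℓ` (`N(ω) = ±ℓ³`) and `θ − a`, hence `θ − a − ℓt ∈ Q ⊓ I = Q·I`, and `N(Q·I) = N(Q)·ℓ` would divide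
`N(θ − a − ℓt) = ∓g(a + ℓt)` — against `ℓ² ∤ g(a + ℓt)`. So `(ω) = Iⁿ` with `ℓⁿ = ℓ³`. DK-free, KERNEL.
[cite: Marcus1977, Ch. 5 Thm. 37 and the worked examples after Cor. 2] [cite: Cohen1993, §4.8.2, §6.3] -/
theorem pow_three_eq_span_of_cert (h3 : Module.finrank ℚ K = 3) (b : 𝓞 K) {p q r : ℤ}
    (hirr : Irreducible (Cubic.toPoly ⟨1, (p : ℚ), q, r⟩)) (hb : b ^ 3 + p * b ^ 2 + q * b + r = 0)
    {ℓ : ℕ} (hℓ : ℓ.Prime)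
    (hcert : ∀ a : ℕ, a < ℓ → (ℓ : ℤ) ∣ (a : ℤ) ^ 3 + p * (a : ℤ) ^ 2 + q * a + r →
      (∃ x y z : ℤ, ∃ m : ℕ, Nat.Coprime m ℓ ∧ (ℓ : ℤ) ∣ x + y * a + z * (a : ℤ) ^ 2 ∧
        (∃ ω : 𝓞 K, (m : 𝓞 K) * ω = (x : 𝓞 K) + y * b + z * b ^ 2) ∧
        (x ^ 3 - p * x ^ 2 * y + (p ^ 2 - 2 * q) * x ^ 2 * z + q * x * y ^ 2 + (3 * r - p * q) * x * y * z
          + (q ^ 2 - 2 * p * r) * x * z ^ 2 - r * y ^ 3 + p * r * y ^ 2 * z - q * r * y * z ^ 2 + r ^ 2 * z ^ 3).natAbs = m ^ 3 * ℓ) ∨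
      (∃ x y z : ℤ, ∃ m : ℕ, Nat.Coprime m ℓ ∧ (ℓ : ℤ) ∣ x + y * a + z * (a : ℤ) ^ 2 ∧
        (∃ ω : 𝓞 K, (m : 𝓞 K) * ω = (x : 𝓞 K) + y * b + z * b ^ 2) ∧
        (x ^ 3 - p * x ^ 2 * y + (p ^ 2 - 2 * q) * x ^ 2 * z + q * x * y ^ 2 + (3 * r - p * q) * x * y * z
          + (q ^ 2 - 2 * p * r) * x * z ^ 2 - r * y ^ 3 + p * r * y ^ 2 * z - q * r * y * z ^ 2 + r ^ 2 * z ^ 3).natAbs = m ^ 3 * ℓ ^ 3 ∧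
        (∃ e : ℕ, ∃ u₀ u₁ u₂ w₀ w₁ w₂ : ℤ, ((u₀ : 𝓞 K) + u₁ * b + u₂ * b ^ 2) * ((x : 𝓞 K) + y * b + z * b ^ 2) =
          (b - (a : 𝓞 K)) ^ e + (ℓ : 𝓞 K) * ((w₀ : 𝓞 K) + w₁ * b + w₂ * b ^ 2)) ∧
        (∃ t : ℤ, ¬ ((ℓ : ℤ) ^ 2 ∣ ((a : ℤ) + ℓ * t) ^ 3 + p * ((a : ℤ) + ℓ * t) ^ 2 + q * ((a : ℤ) + ℓ * t) + r))))
    {I : Ideal (𝓞 K)} (hI : Ideal.absNorm I = ℓ) : ∃ α : 𝓞 K, I ^ 3 = Ideal.span {α} := by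
  have hℓI : ((ℓ : ℕ) : 𝓞 K) ∈ I := by have := Ideal.absNorm_mem I; rwa [hI] at this
  have hIprime : I.IsPrime := Ideal.isPrime_of_irreducible_absNorm (by rw [hI]; exact hℓ)
  have hI0 : I ≠ ⊥ := by intro h; rw [h, Ideal.absNorm_bot] at hI; exact hℓ.ne_zero hI.symm
  have hImax : I.IsMaximal := hIprime.isMaximal hI0
  obtain ⟨a, ha, hab⟩ := exists_sub_natCast_mem_of_absNorm_eq_prime K hℓ hI b
  have hroot := natCast_dvd_of_sub_mem K hℓ hI h3 hb hab
  rcases hcert a ha hroot with ⟨x, y, z, m, hcop, hdvd, ⟨ω, hω⟩, hN⟩ |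
      ⟨x, y, z, m, hcop, hdvd, ⟨ω, hω⟩, hN, ⟨e, u₀, u₁, u₂, w₀, w₁, w₂, hU⟩, ⟨t, hg2⟩⟩
  · -- `I = (ω)` is principal
    obtain ⟨hωI, hNω⟩ := mem_and_natAbs_norm_of_fracWitness K h3 b hirr hb hℓ hI hab hcop hdvd hω hN
    exact ⟨ω ^ 3, by rw [eq_span_singleton_of_mem_of_absNorm_eq K hℓ.ne_zero hI hωI hNω, Ideal.span_singleton_pow]⟩
  · obtain ⟨hωI, hNω⟩ := mem_and_natAbs_norm_of_fracWitness K h3 b hirr hb hℓ hI hab hcop hdvd hω hN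
    -- `I` is the only prime containing `ω`
    have honly : ∀ Q : Ideal (𝓞 K), Q.IsPrime → Q ≠ ⊥ → ω ∈ Q → Q = I := by
      intro Q hQ hQ0 hωQ
      by_contra hne
      have hℓQ : ((ℓ : ℕ) : 𝓞 K) ∈ Q :=
        Literature.NumberTheory.NumberFields.MonicCubic.natCast_mem_of_norm_eq_pow hQ hωQ hNω
      have hTQ : ((x : 𝓞 K) + y * b + z * b ^ 2) ∈ Q := by rw [← hω]; exact Q.mul_mem_left _ hωQ
      -- `θ − a ∈ Q` by the Bézout identity
      have hbaQ : b - (a : 𝓞 K) ∈ Q := by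
        have h1 : ((u₀ : 𝓞 K) + u₁ * b + u₂ * b ^ 2) * ((x : 𝓞 K) + y * b + z * b ^ 2) ∈ Q := Q.mul_mem_left _ hTQ
        rw [hU] at h1
        have h2 : (ℓ : 𝓞 K) * ((w₀ : 𝓞 K) + w₁ * b + w₂ * b ^ 2) ∈ Q := Q.mul_mem_right _ hℓQ
        exact hQ.mem_of_pow_mem e (by simpa using Q.sub_mem h1 h2)
      -- the norm of `Q`
      obtain ⟨i, hi3, hNQ⟩ := (Nat.dvd_prime_pow hℓ).mp (absNorm_dvd_pow_three_of_natCast_mem K h3 hℓQ)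
      have hi1 : 1 ≤ i := by
        by_contra h0
        have hi0 : i = 0 := by omega
        rw [hi0, pow_zero, Ideal.absNorm_eq_one_iff] at hNQ
        exact hQ.ne_top hNQ
      -- `θ − (a + ℓt) ∈ Q ⊓ I = Q * I`
      have hQmax : Q.IsMaximal := hQ.isMaximal hQ0
      have hsup : Q ⊔ I = ⊤ := Ideal.IsMaximal.coprime_of_ne hQmax hImax hne
      have hprod : Q * I = Q ⊓ I := Ideal.mul_eq_inf_of_coprime hsup
      have hmem : b - (((a : ℤ) + ℓ * t : ℤ) : 𝓞 K) ∈ Q * I := by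
        have e : b - (((a : ℤ) + ℓ * t : ℤ) : 𝓞 K) = (b - (a : 𝓞 K)) - ((ℓ : ℕ) : 𝓞 K) * (t : 𝓞 K) := by push_cast; ring
        rw [hprod, e]
        exact ⟨Q.sub_mem hbaQ (Q.mul_mem_right _ hℓQ), I.sub_mem hab (I.mul_mem_right _ hℓI)⟩
      have hdvdN := Ideal.absNorm_dvd_absNorm_of_le ((Ideal.span_singleton_le_iff_mem _).mpr hmem)
      rw [map_mul, hNQ, hI, Ideal.absNorm_span_singleton] at hdvdN
      -- `N(θ − â) = ∓ g(â)`
      have hnb := natAbs_norm_coords_eq_natAbs_normPoly K h3 b hirr hb (-((a : ℤ) + ℓ * t)) 1 0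
      have e2 : (((-((a : ℤ) + ℓ * t)) : ℤ) : 𝓞 K) + ((1 : ℤ) : 𝓞 K) * b + ((0 : ℤ) : 𝓞 K) * b ^ 2 =
          b - (((a : ℤ) + ℓ * t : ℤ) : 𝓞 K) := by push_cast; ring
      rw [e2] at hnb
      rw [hnb] at hdvdN
      have hℓ2 : ℓ ^ 2 ∣ ℓ ^ i * ℓ := by
        rw [← pow_succ]; exact Nat.pow_dvd_pow ℓ (by omega)
      have hZ := Int.ofNat_dvd_left.mpr (hℓ2.trans hdvdN)
      apply hg2
      have e3 : (((a : ℤ) + ℓ * t) ^ 3 + p * ((a : ℤ) + ℓ * t) ^ 2 + q * ((a : ℤ) + ℓ * t) + r) =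
          -((-((a : ℤ) + ℓ * t)) ^ 3 - p * (-((a : ℤ) + ℓ * t)) ^ 2 * 1 + (p ^ 2 - 2 * q) * (-((a : ℤ) + ℓ * t)) ^ 2 * 0
            + q * (-((a : ℤ) + ℓ * t)) * 1 ^ 2 + (3 * r - p * q) * (-((a : ℤ) + ℓ * t)) * 1 * 0
            + (q ^ 2 - 2 * p * r) * (-((a : ℤ) + ℓ * t)) * 0 ^ 2 - r * 1 ^ 3 + p * r * 1 ^ 2 * 0 - q * r * 1 * 0 ^ 2
            + r ^ 2 * 0 ^ 3) := by ring
      rw [e3, Int.dvd_neg]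
      exact_mod_cast hZ
    -- hence `(ω) = I³`
    have hω0 : ω ≠ 0 := by
      rintro rfl
      rw [Algebra.norm_zero, Int.natAbs_zero] at hNω
      exact pow_ne_zero 3 hℓ.ne_zero hNω.symm
    have hsp0 : Ideal.span {ω} ≠ ⊥ := by rwa [Ne, Ideal.span_singleton_eq_bot]
    set n := Multiset.card (normalizedFactors (Ideal.span {ω})) with hn
    have hfac : normalizedFactors (Ideal.span {ω}) = Multiset.replicate n I := by
      refine Multiset.eq_replicate.mpr ⟨rfl, fun Q hQ => ?_⟩
      have hQp : Q.IsPrime := Ideal.isPrime_of_prime (prime_of_normalized_factor Q hQ)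
      have hQ0 : Q ≠ ⊥ := (prime_of_normalized_factor Q hQ).ne_zero
      exact honly Q hQp hQ0 ((Ideal.span_singleton_le_iff_mem Q).mp (Ideal.le_of_dvd (dvd_of_mem_normalizedFactors hQ)))
    have hspan : Ideal.span {ω} = I ^ n := by
      rw [← Ideal.prod_normalizedFactors_eq_self hsp0, hfac, Multiset.prod_replicate]
    have hn3 : n = 3 := by
      have h := congrArg Ideal.absNorm hspan
      rw [Ideal.absNorm_span_singleton, hNω, map_pow, hI] at h
      exact (Nat.pow_right_injective hℓ.one_lt h).symm
    exact ⟨ω, by rw [hspan, hn3]⟩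

/-! ## §3 Transport to `ℚ(θ) ⊂ ℚ̄` -/

/-- **`2 ∤ #Cl(𝓞 ℚ(θ))`** for a root `θ ∈ ℚ̄` of an irreducible `X³ + pX² + qX + r ∈ ℤ[X]`, from «`h_K` odd for EVERY cubic number field
whose integers contain a root» (the form in which the per-field odd certificates are proved). [folklore] -/
theorem not_two_dvd_card_classGroup_adjoin_of_forall_cubicField_odd {p q r : ℤ}
    (hirr : Irreducible (Cubic.toPoly ⟨1, (p : ℚ), q, r⟩))
    (h : ∀ (K : Type) [Field K] [NumberField K], Module.finrank ℚ K = 3 →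
      ∀ b : 𝓞 K, b ^ 3 + p * b ^ 2 + q * b + r = 0 → Odd (NumberField.classNumber K))
    {θ : AlgebraicClosure ℚ} (hθ : aeval θ (Cubic.toPoly ⟨1, (p : ℚ), q, r⟩) = 0) :
    ¬ 2 ∣ Nat.card (ClassGroup (𝓞 (IntermediateField.adjoin ℚ {θ}))) := by
  have hfm : (Cubic.toPoly ⟨1, (p : ℚ), q, r⟩).Monic := Cubic.monic_of_a_eq_one'
  have hθint : IsIntegral ℚ θ := ⟨_, hfm, by rwa [← aeval_def]⟩
  haveI : FiniteDimensional ℚ (IntermediateField.adjoin ℚ {θ}) := IntermediateField.adjoin.finiteDimensional hθint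
  haveI : NumberField (IntermediateField.adjoin ℚ {θ}) := NumberField.mk
  obtain ⟨b, -, hb⟩ := exists_ringOfIntegers_cubic_root (p := p) (q := q) (r := r) hθ
  have h1 := h _ (finrank_adjoin_eq_three_of_irreducible hirr hθ) b hb
  rw [NumberField.classNumber, ← Nat.card_eq_fintype_card] at h1
  exact h1.not_two_dvd_nat

end Summit.BirchSwinnertonDyer.BirchSwinnertonDyer.Theorems.AddKatoTwo

end
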